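import Summits.RiemannHypothesis.RiemannHypothesis.Theorems.LiCoefficientsDefs
import Literature.NumberTheory.LFunctions.NymanBeurlingProofs
import HarnessLib

/-!
# (RH-FREE) Nyman–Beurling tail route, kernel A: the Farey-type partition of `(0,1]`, `q ⊥ steps` (item `NbFluctStepOrthogonal`),
and `∫ h = 1 − γ` (item `NbCondExpIntegral`) — RH-FREE

RH-FREE (per `N`). Nothing here bears on the truth of RH: exact identities of finite-`N` linear algebra and Lebesgue
integrals on `(0,1]`; no convergence or rate statement about `d_N` is made or used.

To land as `Summits/RiemannHypothesis/RiemannHypothesis/Theorems/NymanBeurlingTailKernel.lean` (route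
`NymanBeurlingTail`, rung L-P(P2); items closed here BY NAME: `nbFluctStepOrthogonal_holds : NbFluctStepOrthogonal`,
`nbCondExpIntegral_holds : NbCondExpIntegral`).  `I_{n+1} = nbI n = (1/(n+2), 1/(n+1)]`; `⌊1/x⌋ = n+1` on it;
`(0,1] = ⨆ nbI n` (disjoint); `∫_{I_{n+1}} {1/x} = ∫_{I_{n+1}} h = log(1 + 1/(n+1)) − 1/(n+2)` so `q = {1/x} − h` has mean
zero on every `I_n`; `MeasureTheory.integral_iUnion` sums the pieces; the series `Σ (log(1+1/(n+1)) − 1/(n+2)) = 1 − γ`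
via `Real.tendsto_harmonic_sub_log_add_one`.  Cell rh-li, theory seat rh-li-theory gen 4 (proof sketch, farm rc 0 /
0 sorries inline: HOME/theory/route/nb/LeafNB.lean); the prover files it.
-/

noncomputable section

set_option linter.dupNamespace false

/-! # PARTITION MACHINERY for the NB route (sketch by the theory seat; the prover files it): the Farey-type intervals
`I_{n+1} = (1/(n+2), 1/(n+1)]`, the floor is constant on each, `(0,1]` is their disjoint union. -/

namespace Summit.RiemannHypothesis.RiemannHypothesis.Theorems.NbTheory

open MeasureTheory Set

/-- `nbI n = I_{n+1} = (1/(n+2), 1/(n+1)]`. -/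
def nbI (n : ℕ) : Set ℝ := Set.Ioc (1 / ((n : ℝ) + 2)) (1 / ((n : ℝ) + 1))

/-- `nbI n` is measurable. -/
lemma measurableSet_nbI (n : ℕ) : MeasurableSet (nbI n) := measurableSet_Ioc

/-- `nbI n ⊆ (0, 1]`. -/
lemma nbI_subset (n : ℕ) : nbI n ⊆ Set.Ioc 0 1 := by
  intro x hx
  obtain ⟨h1, h2⟩ := hx
  refine ⟨lt_trans (by positivity) h1, h2.trans ?_⟩
  rw [div_le_one (by positivity)]
  linarith [(n.cast_nonneg : (0 : ℝ) ≤ n)]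

/-- Points of `nbI n` are positive. -/
lemma pos_of_mem_nbI {n : ℕ} {x : ℝ} (hx : x ∈ nbI n) : 0 < x := (nbI_subset n hx).1

/-- On `nbI n`, `⌊1/x⌋₊ = n + 1`. -/
lemma floor_eq_of_mem_nbI {n : ℕ} {x : ℝ} (hx : x ∈ nbI n) : ⌊1 / x⌋₊ = n + 1 := by
  have hx0 : 0 < x := pos_of_mem_nbI hx
  obtain ⟨h1, h2⟩ := hx
  rw [Nat.floor_eq_iff (by positivity)]
  push_cast
  constructor
  · rw [le_div_iff₀ hx0]
    calc ((n : ℝ) + 1) * x ≤ ((n : ℝ) + 1) * (1 / ((n : ℝ) + 1)) := by gcongr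
      _ = 1 := by field_simp
  · rw [div_lt_iff₀ hx0]
    rw [div_lt_iff₀ (by positivity)] at h1
    have : ((n : ℝ) + 1 + 1) * x = x * ((n : ℝ) + 2) := by ring
    linarith

/-- Every `x ∈ (0,1]` lies in `nbI (⌊1/x⌋₊ − 1)`. -/
lemma mem_nbI_of_mem_Ioc {x : ℝ} (hx : x ∈ Set.Ioc (0 : ℝ) 1) : x ∈ nbI (⌊1 / x⌋₊ - 1) := by
  obtain ⟨hx0, hx1⟩ := hx
  have hy1 : (1 : ℝ) ≤ 1 / x := by rw [le_div_iff₀ hx0]; linarith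
  have hN : 1 ≤ ⌊1 / x⌋₊ := by rwa [Nat.one_le_floor_iff]
  have hfl : ((⌊1 / x⌋₊ : ℕ) : ℝ) ≤ 1 / x := Nat.floor_le (by positivity)
  have hlt : 1 / x < ((⌊1 / x⌋₊ : ℕ) : ℝ) + 1 := Nat.lt_floor_add_one _
  have hcast : (((⌊1 / x⌋₊ - 1 : ℕ) : ℝ)) = ((⌊1 / x⌋₊ : ℕ) : ℝ) - 1 := by
    rw [Nat.cast_sub hN]; simp
  refine ⟨?_, ?_⟩
  · rw [hcast, div_lt_iff₀ (by linarith)]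
    rw [div_lt_iff₀ hx0] at hlt
    have : x * (((⌊1 / x⌋₊ : ℕ) : ℝ) - 1 + 2) = (((⌊1 / x⌋₊ : ℕ) : ℝ) + 1) * x := by ring
    linarith
  · rw [hcast, le_div_iff₀ (by linarith)]
    rw [le_div_iff₀ hx0] at hfl
    have : x * (((⌊1 / x⌋₊ : ℕ) : ℝ) - 1 + 1) = ((⌊1 / x⌋₊ : ℕ) : ℝ) * x := by ring
    linarith

/-- `(0,1] = ⋃ₙ nbI n` (the Farey-type partition). -/
lemma Ioc_eq_iUnion_nbI : Set.Ioc (0 : ℝ) 1 = ⋃ n, nbI n := by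
  ext x
  refine ⟨fun hx ↦ Set.mem_iUnion.mpr ⟨_, mem_nbI_of_mem_Ioc hx⟩, fun hx ↦ ?_⟩
  obtain ⟨n, hn⟩ := Set.mem_iUnion.mp hx
  exact nbI_subset n hn

/-- The intervals `nbI n` are pairwise disjoint. -/
lemma pairwise_disjoint_nbI : Pairwise (fun i j ↦ Disjoint (nbI i) (nbI j)) := by
  intro i j hij
  rw [Set.disjoint_left]
  intro x hxi hxj
  have h1 := floor_eq_of_mem_nbI hxi
  have h2 := floor_eq_of_mem_nbI hxj
  omega


/-! ## helper lemmas (bounded measurable functions on `(0,1]`; from SketchNB.lean) -/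

open Literature.NumberTheory.LFunctions Literature.NumberTheory.LFunctions.BaezDuarteOnlyIf

/-- `ρ_{k+1}` is measurable. -/
lemma measurable_nbRho (k : ℕ) : Measurable (nbRho k) :=
  measurable_fract.comp (by fun_prop : Measurable fun x : ℝ ↦ 1 / (((k : ℝ) + 1) * x))

/-- `|ρ_{k+1}(x)| ≤ 1`. -/
lemma abs_nbRho_le (k : ℕ) (x : ℝ) : |nbRho k x| ≤ 1 := by
  rw [nbRho, abs_of_nonneg (Int.fract_nonneg _)]
  exact (Int.fract_lt_one _).le

/-- `0 ≤ m_n`. -/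
lemma nbFareyMean_nonneg (n : ℕ) : 0 ≤ nbFareyMean n := by
  unfold nbFareyMean
  split_ifs with h
  · exact le_rfl
  · have hn : (0 : ℝ) < n := by exact_mod_cast Nat.pos_of_ne_zero h
    have hpos : (0 : ℝ) < 1 + 1 / n := by positivity
    have h2 := Real.one_sub_inv_le_log_of_pos hpos
    have hinv : (1 + 1 / (n : ℝ))⁻¹ = n / (n + 1) := by
      field_simp
    rw [hinv] at h2
    have h3 : 1 - (n : ℝ) / (n + 1) = 1 / (n + 1) := by field_simp; ring
    rw [h3] at h2
    have h4 : (n : ℝ) * (n + 1) * (1 / (n + 1)) ≤ (n : ℝ) * (n + 1) * Real.log (1 + 1 / n) :=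
      mul_le_mul_of_nonneg_left h2 (by positivity)
    have h5 : (n : ℝ) * (n + 1) * (1 / (n + 1)) = n := by field_simp
    linarith

/-- `m_n ≤ 1`. -/
lemma nbFareyMean_le_one (n : ℕ) : nbFareyMean n ≤ 1 := by
  unfold nbFareyMean
  split_ifs with h
  · exact zero_le_one
  · have hn : (0 : ℝ) < n := by exact_mod_cast Nat.pos_of_ne_zero h
    have hpos : (0 : ℝ) < 1 + 1 / n := by positivity
    have h1 := Real.log_le_sub_one_of_pos hpos
    have h4 : (n : ℝ) * (n + 1) * Real.log (1 + 1 / n) ≤ (n : ℝ) * (n + 1) * (1 / n) :=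
      mul_le_mul_of_nonneg_left (by linarith) (by positivity)
    have h5 : (n : ℝ) * (n + 1) * (1 / n) = n + 1 := by field_simp
    linarith

/-- `h` is measurable. -/
lemma measurable_nbStepH : Measurable nbStepH := by
  have hf : Measurable fun x : ℝ ↦ nbFareyMean ⌊1 / x⌋₊ :=
    (measurable_from_nat (f := nbFareyMean)).comp (Nat.measurable_floor.comp (by fun_prop))
  refine Measurable.ite ?_ hf measurable_const
  exact (measurableSet_Ioc : MeasurableSet (Set.Ioc (0 : ℝ) 1))

/-- `|h(x)| ≤ 1`. -/
lemma abs_nbStepH_le (x : ℝ) : |nbStepH x| ≤ 1 := by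
  unfold nbStepH
  split_ifs
  · rw [abs_of_nonneg (nbFareyMean_nonneg _)]
    exact nbFareyMean_le_one _
  · simp

/-- `q` is measurable. -/
lemma measurable_nbFluct : Measurable nbFluct := by
  have hf : Measurable fun x : ℝ ↦ Int.fract (1 / x) - nbStepH x :=
    (measurable_fract.comp (by fun_prop : Measurable fun x : ℝ ↦ 1 / x)).sub measurable_nbStepH
  refine Measurable.ite ?_ hf measurable_const
  exact (measurableSet_Ioc : MeasurableSet (Set.Ioc (0 : ℝ) 1))

/-- `|q(x)| ≤ 2`-type bound (bounded fluctuation). -/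
lemma abs_nbFluct_le (x : ℝ) : |nbFluct x| ≤ 2 := by
  unfold nbFluct
  split_ifs
  · have h1 : |Int.fract (1 / x)| ≤ 1 := by
      rw [abs_of_nonneg (Int.fract_nonneg _)]; exact (Int.fract_lt_one _).le
    have h2 := abs_nbStepH_le x
    calc |Int.fract (1 / x) - nbStepH x| ≤ |Int.fract (1 / x)| + |nbStepH x| := abs_sub _ _
      _ ≤ 2 := by linarith
  · simp

/-- A bounded measurable function is integrable on `(0,1]`. -/
lemma integrableOn_Ioc_of_bounded {f : ℝ → ℝ} (hf : Measurable f) {M : ℝ} (hM : ∀ x, |f x| ≤ M) :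
    IntegrableOn f (Set.Ioc (0 : ℝ) 1) :=
  Measure.integrableOn_of_bounded measure_Ioc_lt_top.ne hf.aestronglyMeasurable
    (ae_of_all _ fun x ↦ by simpa [Real.norm_eq_abs] using hM x)

/-- `h` is integrable on `(0,1]`. -/
lemma integrableOn_nbStepH : IntegrableOn nbStepH (Set.Ioc (0 : ℝ) 1) :=
  integrableOn_Ioc_of_bounded measurable_nbStepH abs_nbStepH_le

/-- `q` is integrable on `(0,1]`. -/
lemma integrableOn_nbFluct : IntegrableOn nbFluct (Set.Ioc (0 : ℝ) 1) :=
  integrableOn_Ioc_of_bounded measurable_nbFluct abs_nbFluct_le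

/-- `ρ_{k+1}·h` is integrable on `(0,1]`. -/
lemma integrableOn_nbRho_mul_nbStepH (k : ℕ) :
    IntegrableOn (fun x ↦ nbRho k x * nbStepH x) (Set.Ioc (0 : ℝ) 1) := by
  refine integrableOn_Ioc_of_bounded ((measurable_nbRho k).mul measurable_nbStepH) (M := 1) fun x ↦ ?_
  rw [abs_mul]
  have := abs_nbRho_le k x
  have := abs_nbStepH_le x
  nlinarith [abs_nonneg (nbRho k x), abs_nonneg (nbStepH x)]

/-- `ρ_{k+1}·q` is integrable on `(0,1]`. -/
lemma integrableOn_nbRho_mul_nbFluct (k : ℕ) :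
    IntegrableOn (fun x ↦ nbRho k x * nbFluct x) (Set.Ioc (0 : ℝ) 1) := by
  refine integrableOn_Ioc_of_bounded ((measurable_nbRho k).mul measurable_nbFluct) (M := 2) fun x ↦ ?_
  rw [abs_mul]
  have := abs_nbRho_le k x
  have := abs_nbFluct_le x
  nlinarith [abs_nonneg (nbRho k x), abs_nonneg (nbFluct x)]

/-! ## integrals over one interval `I_{n+1}` -/

/-- Endpoint inequality of `nbI n`. -/
lemma nbI_endpoints_le (n : ℕ) : 1 / ((n : ℝ) + 2) ≤ 1 / ((n : ℝ) + 1) :=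
  one_div_le_one_div_of_le (by positivity) (by linarith)

/-- `∫_{I_{n+1}} {1/x} dx = log(1 + 1/(n+1)) − 1/(n+2)`. -/
lemma integral_nbI_fract (n : ℕ) :
    ∫ x in nbI n, Int.fract (1 / x) = Real.log (1 + 1 / ((n : ℝ) + 1)) - 1 / ((n : ℝ) + 2) := by
  have hab := nbI_endpoints_le n
  have hcongr : ∫ x in nbI n, Int.fract (1 / x) = ∫ x in nbI n, (x⁻¹ - ((n : ℝ) + 1)) := by
    refine setIntegral_congr_fun (measurableSet_nbI n) fun x hx ↦ ?_
    have hfl := floor_eq_of_mem_nbI hx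
    have hx0 := pos_of_mem_nbI hx
    have hz : ((⌊1 / x⌋ : ℤ) : ℝ) = (n : ℝ) + 1 := by
      have h := Int.natCast_floor_eq_floor (show (0 : ℝ) ≤ 1 / x by positivity)
      rw [hfl] at h
      rw [← h]; push_cast; ring
    rw [← Int.self_sub_floor, hz, one_div]
  rw [hcongr]
  unfold nbI
  rw [← intervalIntegral.integral_of_le hab,
    intervalIntegral.integral_sub ?_ ?_, integral_inv_of_pos (by positivity) (by positivity),
    intervalIntegral.integral_const, smul_eq_mul]
  · have : (1 / ((n : ℝ) + 1)) / (1 / ((n : ℝ) + 2)) = 1 + 1 / ((n : ℝ) + 1) := by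
      field_simp; ring
    rw [this]
    have h1 : (1 / ((n : ℝ) + 1) - 1 / ((n : ℝ) + 2)) * ((n : ℝ) + 1) = 1 / ((n : ℝ) + 2) := by
      field_simp; ring
    rw [h1]
  · refine intervalIntegral.intervalIntegrable_inv (fun x hx ↦ ?_) continuousOn_id
    rw [Set.uIcc_of_le hab] at hx
    exact (lt_of_lt_of_le (by positivity) hx.1).ne'
  · exact intervalIntegrable_const

/-- `∫_{I_{n+1}} h = log(1 + 1/(n+1)) − 1/(n+2)` (the same value: `h` is the conditional mean). -/
lemma integral_nbI_nbStepH (n : ℕ) :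
    ∫ x in nbI n, nbStepH x = Real.log (1 + 1 / ((n : ℝ) + 1)) - 1 / ((n : ℝ) + 2) := by
  have hcongr : ∫ x in nbI n, nbStepH x = ∫ x in nbI n, nbFareyMean (n + 1) := by
    refine setIntegral_congr_fun (measurableSet_nbI n) fun x hx ↦ ?_
    have hx' := nbI_subset n hx
    simp only [nbStepH, hx'.1, hx'.2, and_self, if_true, floor_eq_of_mem_nbI hx]
  rw [hcongr, setIntegral_const]
  unfold nbI
  rw [Real.volume_real_Ioc_of_le (nbI_endpoints_le n), smul_eq_mul, nbFareyMean, if_neg (Nat.succ_ne_zero n)]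
  push_cast
  field_simp
  ring

/-- `{1/x}` is integrable on `nbI n`. -/
lemma integrableOn_nbI_fract (n : ℕ) : IntegrableOn (fun x : ℝ ↦ Int.fract (1 / x)) (nbI n) :=
  (integrableOn_Ioc_of_bounded (measurable_fract.comp (by fun_prop : Measurable fun x : ℝ ↦ 1 / x)) (M := 1)
    fun x ↦ by rw [abs_of_nonneg (Int.fract_nonneg _)]; exact (Int.fract_lt_one _).le).mono_set (nbI_subset n)

/-- The fluctuation `q` has mean zero on every `I_{n+1}` (definition of the conditional expectation `h`). -/
lemma integral_nbI_nbFluct (n : ℕ) : ∫ x in nbI n, nbFluct x = 0 := by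
  have hcongr : ∫ x in nbI n, nbFluct x = ∫ x in nbI n, (Int.fract (1 / x) - nbStepH x) := by
    refine setIntegral_congr_fun (measurableSet_nbI n) fun x hx ↦ ?_
    have hx' := nbI_subset n hx
    simp only [nbFluct, hx'.1, hx'.2, and_self, if_true]
  rw [hcongr, integral_sub (integrableOn_nbI_fract n) (integrableOn_nbStepH.mono_set (nbI_subset n)),
    integral_nbI_fract, integral_nbI_nbStepH, sub_self]

/-! ## K3 — `q ⊥` bounded `I_n`-step functions; K1b, K1c -/

/-- **Item `NbFluctStepOrthogonal` (support): `q` is orthogonal to every bounded `I_n`-step function.** -/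
theorem nbFluctStepOrthogonal_holds :
    (∀ w : ℕ → ℝ, (∃ B : ℝ, ∀ n, |w n| ≤ B) →
    ∫ x in Set.Ioc (0 : ℝ) 1,
        w ⌊1 / x⌋₊ * Summit.RiemannHypothesis.RiemannHypothesis.Theorems.NbTheory.nbFluct x = 0) := by
  intro w ⟨B, hB⟩
  have hB0 : 0 ≤ B := (abs_nonneg _).trans (hB 0)
  have hmeas : Measurable fun x : ℝ ↦ w ⌊1 / x⌋₊ :=
    (measurable_from_nat (f := w)).comp (Nat.measurable_floor.comp (by fun_prop : Measurable fun x : ℝ ↦ 1 / x))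
  have hint : IntegrableOn (fun x : ℝ ↦ w ⌊1 / x⌋₊ * nbFluct x) (Set.Ioc (0 : ℝ) 1) := by
    refine integrableOn_Ioc_of_bounded (hmeas.mul measurable_nbFluct) (M := B * 2) fun x ↦ ?_
    rw [abs_mul]
    exact mul_le_mul (hB _) (abs_nbFluct_le x) (abs_nonneg _) hB0
  rw [Ioc_eq_iUnion_nbI] at hint ⊢
  rw [integral_iUnion measurableSet_nbI pairwise_disjoint_nbI hint]
  have hzero : ∀ n, ∫ x in nbI n, w ⌊1 / x⌋₊ * nbFluct x = 0 := fun n ↦ by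
    have hc : ∫ x in nbI n, w ⌊1 / x⌋₊ * nbFluct x = ∫ x in nbI n, w (n + 1) * nbFluct x :=
      setIntegral_congr_fun (measurableSet_nbI n) fun x hx ↦ by rw [floor_eq_of_mem_nbI hx]
    rw [hc, integral_const_mul, integral_nbI_nbFluct, mul_zero]
  rw [tsum_congr hzero, tsum_zero]

/-- K1c: the steps `{⌊1/x⌋/(k+1)}` are orthogonal to `q`. -/
theorem stepFluct_holds (k : ℕ) :
    ∫ x in Set.Ioc (0 : ℝ) 1, Int.fract ((⌊1 / x⌋₊ : ℝ) / ((k : ℝ) + 1)) * nbFluct x = 0 :=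
  nbFluctStepOrthogonal_holds (fun n ↦ Int.fract ((n : ℝ) / ((k : ℝ) + 1)))
    ⟨1, fun n ↦ by rw [abs_of_nonneg (Int.fract_nonneg _)]; exact (Int.fract_lt_one _).le⟩

/-- K1b: `⟨ρ_1, q⟩ = ⟨h + q, q⟩ = Q`. -/
theorem rho1Fluct_holds : ∫ x in Set.Ioc (0 : ℝ) 1, Int.fract (1 / x) * nbFluct x = nbQ := by
  have hcongr : ∫ x in Set.Ioc (0 : ℝ) 1, Int.fract (1 / x) * nbFluct x =
      ∫ x in Set.Ioc (0 : ℝ) 1, (nbFareyMean ⌊1 / x⌋₊ * nbFluct x + nbFluct x ^ 2) := by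
    refine setIntegral_congr_fun measurableSet_Ioc fun x hx ↦ ?_
    have h1 : Int.fract (1 / x) = nbStepH x + nbFluct x := by
      simp only [nbFluct, hx.1, hx.2, and_self, if_true]; ring
    have h2 : nbStepH x = nbFareyMean ⌊1 / x⌋₊ := by
      simp only [nbStepH, hx.1, hx.2, and_self, if_true]
    rw [h1, h2]; ring
  have hmeas : Measurable fun x : ℝ ↦ nbFareyMean ⌊1 / x⌋₊ :=
    (measurable_from_nat (f := nbFareyMean)).comp (Nat.measurable_floor.comp (by fun_prop : Measurable fun x : ℝ ↦ 1 / x))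
  have hbd : ∀ n, |nbFareyMean n| ≤ 1 := fun n ↦
    abs_le.mpr ⟨by linarith [nbFareyMean_nonneg n], nbFareyMean_le_one n⟩
  have i1 : IntegrableOn (fun x : ℝ ↦ nbFareyMean ⌊1 / x⌋₊ * nbFluct x) (Set.Ioc (0 : ℝ) 1) := by
    refine integrableOn_Ioc_of_bounded (hmeas.mul measurable_nbFluct) (M := 1 * 2) fun x ↦ ?_
    rw [abs_mul]
    exact mul_le_mul (hbd _) (abs_nbFluct_le x) (abs_nonneg _) zero_le_one
  have i2 : IntegrableOn (fun x : ℝ ↦ nbFluct x ^ 2) (Set.Ioc (0 : ℝ) 1) := by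
    refine integrableOn_Ioc_of_bounded (measurable_nbFluct.pow_const 2) (M := 4) fun x ↦ ?_
    rw [abs_pow]
    have := abs_nbFluct_le x
    nlinarith [abs_nonneg (nbFluct x)]
  rw [hcongr, integral_add i1 i2, nbFluctStepOrthogonal_holds nbFareyMean ⟨1, hbd⟩, zero_add, nbQ]
/-! ## K4 — `∫_{(0,1]} h = Σ_n (log(1+1/n) − 1/(n+1)) = 1 − γ` (route item `NbCondExpIntegral`, PROVED) -/

/-- Partial sums of `Σ (log(1+1/(n+1)) − 1/(n+2))` in closed form. -/
lemma sum_range_nbTerm (N : ℕ) :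
    ∑ n ∈ Finset.range N, (Real.log (1 + 1 / ((n : ℝ) + 1)) - 1 / ((n : ℝ) + 2)) =
      1 - ((harmonic N : ℝ) - Real.log ((N : ℝ) + 1)) - 1 / ((N : ℝ) + 1) := by
  induction N with
  | zero => simp
  | succ N ih =>
    rw [Finset.sum_range_succ, ih, harmonic_succ]
    push_cast
    have h1 : Real.log (1 + 1 / ((N : ℝ) + 1)) = Real.log ((N : ℝ) + 1 + 1) - Real.log ((N : ℝ) + 1) := by
      rw [← Real.log_div (by positivity) (by positivity)]
      congr 1
      field_simp
    rw [h1]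
    field_simp
    ring

/-- The terms `log(1+1/(n+1)) − 1/(n+2)` are non-negative. -/
lemma nbTerm_nonneg (n : ℕ) : 0 ≤ Real.log (1 + 1 / ((n : ℝ) + 1)) - 1 / ((n : ℝ) + 2) := by
  have h := Real.one_sub_inv_le_log_of_pos (show (0 : ℝ) < 1 + 1 / ((n : ℝ) + 1) by positivity)
  have : (1 + 1 / ((n : ℝ) + 1))⁻¹ = 1 - 1 / ((n : ℝ) + 2) := by
    field_simp
    ring
  linarith

/-- `Σₙ (log(1+1/(n+1)) − 1/(n+2)) = 1 − γ` (`Real.tendsto_harmonic_sub_log_add_one`). -/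
lemma hasSum_nbTerm :
    HasSum (fun n : ℕ ↦ Real.log (1 + 1 / ((n : ℝ) + 1)) - 1 / ((n : ℝ) + 2))
      (1 - Real.eulerMascheroniConstant) := by
  rw [hasSum_iff_tendsto_nat_of_nonneg nbTerm_nonneg]
  have h : Filter.Tendsto (fun N : ℕ ↦ 1 - ((harmonic N : ℝ) - Real.log ((N : ℝ) + 1)) - 1 / ((N : ℝ) + 1))
      Filter.atTop (nhds (1 - Real.eulerMascheroniConstant - 0)) :=
    (tendsto_const_nhds.sub Real.tendsto_harmonic_sub_log_add_one).sub tendsto_one_div_add_atTop_nhds_zero_nat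
  rw [sub_zero] at h
  exact h.congr fun N ↦ (sum_range_nbTerm N).symm

/-- **Item `NbCondExpIntegral` (support): `∫_0^1 h = 1 − γ`.** -/
theorem nbCondExpIntegral_holds :
    (∫ x in Set.Ioc (0 : ℝ) 1, Summit.RiemannHypothesis.RiemannHypothesis.Theorems.NbTheory.nbStepH x =
    1 - Real.eulerMascheroniConstant) := by
  show ∫ x in Set.Ioc (0 : ℝ) 1, nbStepH x = 1 - Real.eulerMascheroniConstant
  have hint := integrableOn_nbStepH
  rw [Ioc_eq_iUnion_nbI] at hint ⊢
  rw [integral_iUnion measurableSet_nbI pairwise_disjoint_nbI hint]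
  simp_rw [integral_nbI_nbStepH]
  exact hasSum_nbTerm.tsum_eq

end Summit.RiemannHypothesis.RiemannHypothesis.Theorems.NbTheory

end
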